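import Summits.RiemannHypothesis.RiemannHypothesis.Theorems.ScrewChristoffelBound
import Mathlib.Analysis.Matrix.LDL
import HarnessLib

/-!
# The Christoffel law of the screw Gram chain, IV: «E_M FROM H_M» in the kernel — `K_M(γ,γ) = Σ_m E_m(γ)²/d_m` (RH-FREE; EM-3d)

LINE 1 — LABEL: RH-FREE linear algebra (the LDLᵀ / innovation identity for ANY positive definite real matrix, instantiated
at the nested screw Gram matrices); nothing about the zeros of `ζ` enters. bears_on: LADDER-RH B-D → B-P (cell rh-dbr, seat
rh-dbr-eng-5 «find: de Branges structure functions E_M(z) from H_M»: this file TYPES the seat's instrument — EM-1 computed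
`λ_M(γ) = γ²/Σ_{m≤M}|E_m(γ)|²/d_m` from the innovation rows `C = L⁻¹` and the pivots `d_m` of the LDLᵀ factorisation of
`S_M` (HOME/DATA/code/em5/lineageA.py «H_M := innovation data of the nested chain»), while EM-3 (`Theorems.ScrewChristoffelBound`)
reasons with `K_M(γ,γ) = cᵀS_M⁻¹c + sᵀS_M⁻¹s`; here the two are PROVED EQUAL). WHAT THIS IS NOT: progress toward RH; an identity
between two of the cell's own instruments, nothing more.

With Mathlib's LDL decomposition of a positive definite `S` (`LDL.lowerInv hS = Λ` unit lower-triangular up to normalisation —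
the Gram–Schmidt / innovation matrix, `LDL.diag hS = Λ S Λᴴ` diagonal with entries `d_m`, `LDL.lower hS = Λ⁻¹ = L`, `S = L D Lᴴ`):
* `inv_eq_lowerInv_transpose_mul` — `S⁻¹ = Λᵀ D⁻¹ Λ` (RH-FREE);
* `diag_apply_pos` — the pivots `d_m = Λ_m S Λ_mᵀ > 0`;
* **`dotProduct_inv_mulVec_eq_sum_sq_div`** — `vᵀ S⁻¹ v = Σ_m (Λ v)_m² / d_m` for every `v`;
* **`christoffel_eq_sum_innovation_sq_div`** — at `S_{n+1} = screwMatrix n` and the frequency vectors `c, s` of EM-3: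
  `K_{n+1}(γ,γ) = Σ_m ((Λc)_m² + (Λs)_m²)/d_m = Σ_m |E_m(γ)|²/d_m` with `E_m(γ) := (Λ v(γ))_m = Σ_a Λ_{m,a}(a^{iγ} − 1)`
  (real part `(Λc)_m`, imaginary part `(Λs)_m`) — EM-1's formula.

References: standard (LDLᵀ / Cholesky and reproducing kernels of nested finite-dimensional spaces); P. Nevai, J. Approx. Theory 48
(1986) §4.1 (`K_n(x,x) = Σ_k p_k(x)²` for orthonormal systems).
-/

-- `Summit.RiemannHypothesis.RiemannHypothesis.…` duplicates `RiemannHypothesis` BY DESIGN (D-0017).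
set_option linter.dupNamespace false

noncomputable section

open Finset Matrix
open scoped BigOperators

namespace Summit.RiemannHypothesis.RiemannHypothesis.Theorems.ScrewChristoffel

open Summit.RiemannHypothesis.RiemannHypothesis.Theorems.IntegerScrew

/-! ## §1 RH-FREE: `S⁻¹ = Λᵀ D⁻¹ Λ` and `vᵀS⁻¹v = Σ (Λv)_m²/d_m` for a positive definite real matrix -/

section Generic

variable {n : Type*} [Fintype n] [LinearOrder n] [LocallyFiniteOrderBot n] [WellFoundedLT n]
  {S : Matrix n n ℝ} (hS : S.PosDef)

/-- The pivot `d_m` is the `S`-energy of the `m`-th innovation row: `D m m = (S Λ_m) · Λ_m`. [folklore] -/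
theorem diag_apply_eq (m : n) :
    LDL.diag hS m m = (S *ᵥ LDL.lowerInv hS m) ⬝ᵥ LDL.lowerInv hS m := by
  simp [LDL.diag, LDL.diagEntries, EuclideanSpace.inner_toLp_toLp]

/-- The rows of the innovation matrix `Λ` are non-zero (it is invertible). [folklore] -/
theorem lowerInv_row_ne_zero (m : n) : LDL.lowerInv hS m ≠ 0 := by
  intro h
  have hdet : (LDL.lowerInv hS).det = 0 := det_eq_zero_of_row_eq_zero m fun j => by simp [h]
  have hunit : IsUnit (LDL.lowerInv hS).det := (Matrix.isUnit_iff_isUnit_det _).1 (isUnit_of_invertible _)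
  exact hunit.ne_zero hdet

/-- The pivots are positive: `0 < d_m`. [folklore] -/
theorem diag_apply_pos (m : n) : 0 < LDL.diag hS m m := by
  rw [diag_apply_eq, dotProduct_comm]
  have h := hS.dotProduct_mulVec_pos (lowerInv_row_ne_zero hS m)
  rwa [star_trivial] at h

/-- Off-diagonal entries of `D` vanish. [folklore] -/
theorem diag_apply_ne {i j : n} (h : i ≠ j) : LDL.diag hS i j = 0 := by
  simp [LDL.diag, h]

/-- `D` is the diagonal matrix of its diagonal. [folklore] -/
theorem diag_eq_diagonal : LDL.diag hS = diagonal fun m => LDL.diag hS m m := by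
  ext i j
  by_cases h : i = j
  · subst h; simp
  · rw [diag_apply_ne hS h, diagonal_apply_ne _ h]

/-- `D⁻¹ = diag(1/d_m)`. [folklore] -/
theorem diag_inv_eq : (LDL.diag hS)⁻¹ = diagonal fun m => (LDL.diag hS m m)⁻¹ := by
  refine Matrix.inv_eq_left_inv ?_
  rw [diag_eq_diagonal hS, diagonal_mul_diagonal]
  convert diagonal_one with m
  simp only [diagonal_apply_eq]
  exact inv_mul_cancel₀ (diag_apply_pos hS m).ne'

/-- `det D ≠ 0`. [folklore] -/
theorem isUnit_det_diag : IsUnit (LDL.diag hS).det := by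
  rw [diag_eq_diagonal hS, det_diagonal]
  exact isUnit_iff_ne_zero.2 (prod_ne_zero_iff.2 fun m _ => (diag_apply_pos hS m).ne')

/-- **`S⁻¹ = Λᵀ D⁻¹ Λ`** (`Λ = LDL.lowerInv`, from `S = L D Lᵀ`, `L = Λ⁻¹`). RH-FREE. [folklore] -/
theorem inv_eq_lowerInv_transpose_mul :
    S⁻¹ = (LDL.lowerInv hS)ᵀ * (LDL.diag hS)⁻¹ * LDL.lowerInv hS := by
  have h := LDL.lower_conj_diag hS
  rw [conjTranspose_eq_transpose_of_trivial] at h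
  simp only [LDL.lower] at h
  have hΛ : IsUnit (LDL.lowerInv hS).det := (Matrix.isUnit_iff_isUnit_det _).1 (isUnit_of_invertible _)
  have hΛT : IsUnit (LDL.lowerInv hS)ᵀ.det := by rw [det_transpose]; exact hΛ
  have hD := isUnit_det_diag hS
  apply Matrix.inv_eq_left_inv
  calc (LDL.lowerInv hS)ᵀ * (LDL.diag hS)⁻¹ * LDL.lowerInv hS * S
      = (LDL.lowerInv hS)ᵀ * (LDL.diag hS)⁻¹ * LDL.lowerInv hS *
          ((LDL.lowerInv hS)⁻¹ * LDL.diag hS * ((LDL.lowerInv hS)⁻¹)ᵀ) := by rw [h]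
    _ = (LDL.lowerInv hS)ᵀ * ((LDL.diag hS)⁻¹ * ((LDL.lowerInv hS * (LDL.lowerInv hS)⁻¹) * LDL.diag hS)) *
          ((LDL.lowerInv hS)⁻¹)ᵀ := by simp only [Matrix.mul_assoc]
    _ = 1 := by
        rw [mul_nonsing_inv _ hΛ, Matrix.one_mul, nonsing_inv_mul _ hD, Matrix.mul_one, transpose_nonsing_inv,
          mul_nonsing_inv _ hΛT]

omit [LinearOrder n] [LocallyFiniteOrderBot n] [WellFoundedLT n] in
/-- For real matrices, `v · (Λᵀ w) = (Λ v) · w`. [folklore] -/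
theorem dotProduct_transpose_mulVec (Λ : Matrix n n ℝ) (v w : n → ℝ) : v ⬝ᵥ (Λᵀ *ᵥ w) = (Λ *ᵥ v) ⬝ᵥ w := by
  rw [dotProduct_mulVec, vecMul_transpose]

/-- **The innovation (LDLᵀ) form of the inverse quadratic form**: `vᵀ S⁻¹ v = Σ_m (Λ v)_m² / d_m`. RH-FREE. [folklore] -/
theorem dotProduct_inv_mulVec_eq_sum_sq_div (v : n → ℝ) :
    v ⬝ᵥ (S⁻¹ *ᵥ v) = ∑ m, ((LDL.lowerInv hS *ᵥ v) m) ^ 2 / LDL.diag hS m m := by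
  rw [inv_eq_lowerInv_transpose_mul hS, Matrix.mul_assoc, ← mulVec_mulVec, dotProduct_transpose_mulVec,
    ← mulVec_mulVec, diag_inv_eq hS]
  simp only [dotProduct, mulVec_diagonal]
  exact sum_congr rfl fun m _ => by rw [div_eq_mul_inv]; ring

end Generic

/-! ## §2 The screw Gram chain: `K_M(γ,γ) = Σ_m |E_m(γ)|²/d_m` (EM-1's formula = EM-3's formula) -/

variable (n : ℕ)

/-- **«E_M FROM H_M» — EM-1's Christoffel formula IS EM-3's**: for `S_{n+1} = screwMatrix n ≻ 0` with innovation matrix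
`Λ = LDL.lowerInv` and pivots `d_m = (LDL.diag) m m`, and the frequency vectors `c_i = cos(γ log(i+2)) − 1`, `s_i = sin(γ log(i+2))`:
`cᵀS⁻¹c + sᵀS⁻¹s = Σ_m ((Λc)_m² + (Λs)_m²)/d_m` — i.e. `K_M(γ,γ) = Σ_{m} |E_m(γ)|²/d_m` with the structure functions
`E_m(γ) = Σ_a Λ_{m,a}(a^{iγ} − 1) = (Λc)_m + i(Λs)_m` of the nested chain (HOME/DATA.md §EM-1). RH-FREE identity; `S ≻ 0` is a
kernel theorem for `M ≤ 128` and RH-equivalent for all `M`. Nothing here bears on RH. [folklore] -/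
theorem christoffel_eq_sum_innovation_sq_div (hS : (screwMatrix n).PosDef) (γ : ℝ) :
    (fun i : Fin n => Real.cos (γ * Real.log (((i : ℕ) + 2 : ℕ) : ℝ)) - 1) ⬝ᵥ
          ((screwMatrix n)⁻¹ *ᵥ fun i : Fin n => Real.cos (γ * Real.log (((i : ℕ) + 2 : ℕ) : ℝ)) - 1) +
        (fun i : Fin n => Real.sin (γ * Real.log (((i : ℕ) + 2 : ℕ) : ℝ))) ⬝ᵥ
          ((screwMatrix n)⁻¹ *ᵥ fun i : Fin n => Real.sin (γ * Real.log (((i : ℕ) + 2 : ℕ) : ℝ))) =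
      ∑ m : Fin n,
        (((LDL.lowerInv hS *ᵥ fun i : Fin n => Real.cos (γ * Real.log (((i : ℕ) + 2 : ℕ) : ℝ)) - 1) m) ^ 2 +
          ((LDL.lowerInv hS *ᵥ fun i : Fin n => Real.sin (γ * Real.log (((i : ℕ) + 2 : ℕ) : ℝ))) m) ^ 2) /
          LDL.diag hS m m := by
  rw [dotProduct_inv_mulVec_eq_sum_sq_div hS, dotProduct_inv_mulVec_eq_sum_sq_div hS, ← sum_add_distrib]
  exact sum_congr rfl fun m _ => by rw [add_div]

/-- Each innovation term is a LOWER BOUND for the Christoffel reading: `|E_m(γ)|²/d_m ≤ K_M(γ,γ)` (all terms are `≥ 0`).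
With EM-3 (`christoffel_le_of_riemannHypothesis`): under RH, `|E_m(γ₀)|² ≤ d_m·γ₀²/m(ρ₀)` for every `m ≤ M` and every zero.
RH-FREE here. [folklore] -/
theorem innovation_sq_div_le_christoffel (hS : (screwMatrix n).PosDef) (γ : ℝ) (m : Fin n) :
    (((LDL.lowerInv hS *ᵥ fun i : Fin n => Real.cos (γ * Real.log (((i : ℕ) + 2 : ℕ) : ℝ)) - 1) m) ^ 2 +
        ((LDL.lowerInv hS *ᵥ fun i : Fin n => Real.sin (γ * Real.log (((i : ℕ) + 2 : ℕ) : ℝ))) m) ^ 2) /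
        LDL.diag hS m m ≤
      (fun i : Fin n => Real.cos (γ * Real.log (((i : ℕ) + 2 : ℕ) : ℝ)) - 1) ⬝ᵥ
          ((screwMatrix n)⁻¹ *ᵥ fun i : Fin n => Real.cos (γ * Real.log (((i : ℕ) + 2 : ℕ) : ℝ)) - 1) +
        (fun i : Fin n => Real.sin (γ * Real.log (((i : ℕ) + 2 : ℕ) : ℝ))) ⬝ᵥ
          ((screwMatrix n)⁻¹ *ᵥ fun i : Fin n => Real.sin (γ * Real.log (((i : ℕ) + 2 : ℕ) : ℝ))) := by
  rw [christoffel_eq_sum_innovation_sq_div n hS γ]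
  exact single_le_sum (s := univ)
    (f := fun k : Fin n =>
      (((LDL.lowerInv hS *ᵥ fun i : Fin n => Real.cos (γ * Real.log (((i : ℕ) + 2 : ℕ) : ℝ)) - 1) k) ^ 2 +
          ((LDL.lowerInv hS *ᵥ fun i : Fin n => Real.sin (γ * Real.log (((i : ℕ) + 2 : ℕ) : ℝ))) k) ^ 2) /
        LDL.diag hS k k)
    (fun k _ => div_nonneg (add_nonneg (sq_nonneg _) (sq_nonneg _)) (diag_apply_pos hS k).le) (mem_univ m)

end Summit.RiemannHypothesis.RiemannHypothesis.Theorems.ScrewChristoffel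

end
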